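import Mathlib
import HarnessLib
import Summits.Ventures.LatticeQCDFlow.Exactness.CabibboMarinariOverrelax
import Summits.Ventures.LatticeQCDFlow.Exactness.CabibboMarinariORSweep
import Summits.Ventures.LatticeQCDFlow.Scoring.SU2Cooling
import Summits.Ventures.LatticeQCDFlow.Scoring.WilsonStapleSum

/-!
# The engine's `SU(N)` Cabibbo–Marinari COOLING hit is the exact minimiser of the link action over its `SU(2)` coset, so cooling never increases the Wilson action — every `N`, every schedule

HONEST FRAMING: exact (Metropolis-corrected) sampling algorithms for lattice gauge theory;
figures of merit are autocorrelation/cost numbers at stated couplings and volumes; no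
continuum-physics claim.

Venture `LatticeQCDFlow` (cell pub-lqcd), topic `Exactness`, FANOUT row 21 (`su3-base`: the row's topological
charge of record is the α-rounded clover charge `Q_L` after `n_cool = 60` COOLING sweeps of the `SU(3)` field,
`latflow.core.updates.sweep(f, β, 'cool')` = `csrc` `update_link(mode COOL)`: for every link, serially, and every
subgroup pair `(i, j)`, `i < j`, read `W = U R`, project the `(i, j)` block to `k v` (`v ∈ SU(2)`, `k ≥ 0`) and, if
`k > 0`, left-multiply the link by the embedded `v†` — "alpha = … v^dag (COOL)"; row 21's definition-of-record note
CARD §13 2026-08-21 / `COOLING-TRAVERSAL.md`: the cooled field depends on the VISITING ORDER).  NEW WORK of the cell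
over the tree (row 9: `CabibboMarinariOverrelax.lean` — the quaternion `cmQuat e R g = k ŝ` of the block of `gR`,
its unit `cmUnit`, `re_trace_blockEmb_mul`; `CabibboMarinariQuat.lean` — polar form; row 16: `Scoring/SU2Cooling`
— `Re tr (g Q) ≤ 2√|Q|²` on `SU(2)` with equality only at `g = ŝ⁻¹`; `Scoring/WilsonStapleSum` — the exact local
action difference `S_W(h ·_e U) − S_W(U) = Re tr(U_e R_e) − Re tr(h U_e R_e)` for `L ≥ 2`).  Nothing is cited as
a fact; no number.  Printed counterparts, NAMED ONLY: Cabibbo–Marinari 1982 (subgroup updates); Hoek–Teper–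
Waterhouse, NPB 288 (1987) 589 (cooling); `Scoring/SU2Cooling` lists "`SU(N ≥ 3)` (no closed-form minimiser;
Cabibbo–Marinari subgroup cooling)" as NOT CLAIMED — this file types what IS closed-form: each subgroup hit.

## What is proved

§1 one link `g ∈ SU(n)`, any frame `e : n ≃ Fin 2 ⊕ m`, any staple matrix `R`:
* **`cmCool e R g = φ(ŝ(g)⁻¹) · g`** — the engine's cooling hit (the identity on the null coset `k = 0`, where `ŝ = 1`);
* `re_trace_blockEmbSU_mul` — along the coset, `Re tr(φ(A) g R) = ½ Re tr(A · Q(g)) + Re tr((gR)₂₂)`;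
  `re_trace_cmUnit_inv_mul` — `Re tr(ŝ⁻¹ Q) = 2√|Q|²`;
* **`re_trace_coset_le_cmCool`** — `Re tr(φ(A) g R) ≤ Re tr(cmCool(g) R)` for EVERY `A ∈ SU(2)`: the hit MAXIMISES
  `Re tr(· R)` over the coset `φ(SU(2)) g`, i.e. minimises the one-link action there; `re_trace_le_cmCool` (`A = 1`);
* **`eq_cmCool_of_re_trace_eq`** — off the null coset the maximiser is UNIQUE: equality forces `φ(A) g = cmCool(g)`
  (so two exact implementations of the hit agree link by link; they can differ only through the visiting order).

§2 the lattice (`G = SU(N)` in the defining representation `suRep N`, torus `(ℤ/L)^d`, `L ≥ 2`):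
* **`cmLatCool e x μ U`** — the engine's hit of link `(x, μ)` in frame `e`, staples `R = stapleSum (suRep N) U x μ`;
  `cmLatCool_apply_self` / `cmLatCool_apply_of_ne`;
* **`wilsonAction_cmLatCool_le_coset`** — `S_W(cmLatCool U) ≤ S_W(φ(A) ·_{(x,μ)} U)` for every `A ∈ SU(2)`;
  **`wilsonAction_cmLatCool_le`** — `S_W(cmLatCool U) ≤ S_W(U)`;
* **`cmCoolSchedule`** — any list of (link, frame) hits applied in order (the engine: `n_cool` sweeps × every link
  serially × every pair `i < j`); **`wilsonAction_cmCoolSchedule_le`** — the Wilson action never increases, for EVERY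
  schedule; `wilsonAction_cmCoolSchedule_append_le` — continuing a schedule never increases it either.

NOT CLAIMED: that a full sweep reaches the minimiser over the whole `SU(N)` fibre (false in general for `N ≥ 3`:
the subgroup hits do not commute); convergence of iterated cooling, plateaux, integrality of the cooled charge;
the dependence on the visiting order (it is real — row 21 / row 9 `COOLING-TRAVERSAL.md`); floating point (the
engine skips the hit when `k < 10⁻¹²`, here when `k = 0`); any number.
-/

noncomputable section

namespace Summit.Ventures.LatticeQCDFlow.Exactness

open Matrix
open Literature.MathematicalPhysics.QuantumFieldTheory
open scoped Matrix

/-! ## §1 One link: the cooling hit maximises `Re tr(· R)` over its `SU(2)` coset -/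

section OneLink

variable {n m : Type*} [Fintype n] [DecidableEq n] [Fintype m] [DecidableEq m]
  (e : n ≃ Fin 2 ⊕ m) (R : Matrix n n ℂ)

/-- **The engine's Cabibbo–Marinari COOLING hit** in the frame `e` with staple matrix `R`:
`g ↦ φ(ŝ(g)⁻¹) · g`, `ŝ(g)` the unit quaternion of the `e`-block of `gR` (`= 1` on the null coset). -/
def cmCool (g : Matrix.specialUnitaryGroup n ℂ) : Matrix.specialUnitaryGroup n ℂ :=
  blockEmbSU e (cmUnit e R g)⁻¹ * g

/-- **Along the coset**: `Re tr(φ(A) g R) = ½ Re tr(A · Q(g)) + Re tr((gR)₂₂)` — only the first term sees `A`. -/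
theorem re_trace_blockEmbSU_mul (A : Matrix.specialUnitaryGroup (Fin 2) ℂ) (g : Matrix.specialUnitaryGroup n ℂ) :
    (((↑(blockEmbSU e A * g) : Matrix n n ℂ) * R).trace).re
      = (1 / 2 : ℝ) * (((A : Matrix (Fin 2) (Fin 2) ℂ) * cmQuat e R g).trace).re
        + (((((g : Matrix n n ℂ) * R).submatrix e.symm e.symm).toBlocks₂₂).trace).re := by
  rw [Submonoid.coe_mul, coe_blockEmbSU, Matrix.mul_assoc, re_trace_blockEmb_mul, cmQuat,
    ← (IsQuat.of_mem_specialUnitaryGroup A.2).two_mul_re_trace_mul]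
  ring

omit [Fintype m] [DecidableEq m] in
/-- **The value at the hit**: `Re tr(ŝ⁻¹ · Q) = 2 √|Q|²` (`Q = √|Q|² ŝ`). -/
theorem re_trace_cmUnit_inv_mul (g : Matrix.specialUnitaryGroup n ℂ) :
    ((((cmUnit e R g)⁻¹ : Matrix.specialUnitaryGroup (Fin 2) ℂ) : Matrix (Fin 2) (Fin 2) ℂ) * cmQuat e R g).trace.re
      = 2 * √(IsQuat.normSq (cmQuat e R g)) := by
  set k : ℝ := √(IsQuat.normSq (cmQuat e R g)) with hk
  set u := cmUnit e R g with hu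
  have hQ : cmQuat e R g = (k : ℂ) • (u : Matrix (Fin 2) (Fin 2) ℂ) := by
    rw [hu, coe_cmUnit, hk, quatUnit_smul (isQuat_cmQuat e R g)]
  have huu : (↑(u⁻¹) : Matrix (Fin 2) (Fin 2) ℂ) * (u : Matrix (Fin 2) (Fin 2) ℂ) = 1 := by
    rw [← Submonoid.coe_mul, inv_mul_cancel]; rfl
  rw [hQ, Matrix.mul_smul, Matrix.trace_smul, huu, Matrix.trace_one, Fintype.card_fin, smul_eq_mul,
    Complex.re_ofReal_mul]
  norm_num
  ring

/-- **THE COOLING HIT MAXIMISES `Re tr(· R)` OVER THE SUBGROUP COSET**: for every `A ∈ SU(2)`,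
`Re tr(φ(A) g R) ≤ Re tr(cmCool(g) R)` — equivalently it minimises the one-link Wilson action
`2(d−1)N − Re tr(g' R)` among all `g' ∈ φ(SU(2)) · g`. -/
theorem re_trace_coset_le_cmCool (A : Matrix.specialUnitaryGroup (Fin 2) ℂ) (g : Matrix.specialUnitaryGroup n ℂ) :
    (((↑(blockEmbSU e A * g) : Matrix n n ℂ) * R).trace).re
      ≤ (((↑(cmCool e R g) : Matrix n n ℂ) * R).trace).re := by
  rw [cmCool, re_trace_blockEmbSU_mul, re_trace_blockEmbSU_mul, re_trace_cmUnit_inv_mul]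
  have h := Scoring.re_trace_mul_le A.2 (isQuat_cmQuat e R g)
  linarith

/-- In particular the hit never decreases `Re tr(g R)` (take `A = 1`). -/
theorem re_trace_le_cmCool (g : Matrix.specialUnitaryGroup n ℂ) :
    (((g : Matrix n n ℂ) * R).trace).re ≤ (((↑(cmCool e R g) : Matrix n n ℂ) * R).trace).re := by
  have h := re_trace_coset_le_cmCool e R 1 g
  rwa [map_one, one_mul] at h

/-- **Uniqueness off the null coset**: if `k = √|Q(g)|² ≠ 0` and `φ(A) g` does as well as the hit, then
`φ(A) g = cmCool(g)` — every exact implementation of the subgroup cooling hit computes the same link. -/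
theorem eq_cmCool_of_re_trace_eq {g : Matrix.specialUnitaryGroup n ℂ} (h0 : IsQuat.normSq (cmQuat e R g) ≠ 0)
    (A : Matrix.specialUnitaryGroup (Fin 2) ℂ)
    (h : (((↑(blockEmbSU e A * g) : Matrix n n ℂ) * R).trace).re = (((↑(cmCool e R g) : Matrix n n ℂ) * R).trace).re) :
    blockEmbSU e A * g = cmCool e R g := by
  set k : ℝ := √(IsQuat.normSq (cmQuat e R g)) with hk
  set u := cmUnit e R g with hu
  have hkpos : 0 < k := Real.sqrt_pos.2 (lt_of_le_of_ne (IsQuat.normSq_nonneg _) (Ne.symm h0))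
  have hQ : cmQuat e R g = (k : ℂ) • (u : Matrix (Fin 2) (Fin 2) ℂ) := by
    rw [hu, coe_cmUnit, hk, quatUnit_smul (isQuat_cmQuat e R g)]
  rw [cmCool, re_trace_blockEmbSU_mul, re_trace_blockEmbSU_mul, re_trace_cmUnit_inv_mul, ← hk] at h
  -- `Re tr(A Q) = 2k`, `Q = k u` ⇒ `Re tr(A u) = 2` ⇒ `A u = 1`
  have hAQ : (((A : Matrix (Fin 2) (Fin 2) ℂ) * cmQuat e R g).trace).re = 2 * k := by linarith
  rw [hQ, Matrix.mul_smul, Matrix.trace_smul, smul_eq_mul, Complex.re_ofReal_mul] at hAQ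
  have hAu : (((A : Matrix (Fin 2) (Fin 2) ℂ) * (u : Matrix (Fin 2) (Fin 2) ℂ)).trace).re = 2 := by
    have := mul_left_cancel₀ hkpos.ne' (hAQ.trans (mul_comm _ _))
    exact this
  have hAu1 : (A : Matrix (Fin 2) (Fin 2) ℂ) * (u : Matrix (Fin 2) (Fin 2) ℂ) = 1 :=
    Scoring.eq_one_of_re_trace_eq_two (Submonoid.mul_mem _ A.2 u.2) hAu
  have hA : A = u⁻¹ := by
    rw [eq_inv_iff_mul_eq_one]
    exact Subtype.ext hAu1
  rw [hA, hu, cmCool]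

end OneLink

/-! ## §2 The lattice: the engine's cooling hit and schedules never increase the Wilson action -/

section Lattice

variable {N d L : ℕ} {m : Type*} [Fintype m] [DecidableEq m]

/-- **The engine's lattice cooling hit** of the link `(x, μ)` in the frame `e`: left-multiply the link by
`φ(ŝ⁻¹)`, `ŝ` the unit quaternion of the `e`-block of `U_{(x,μ)} R_{(x,μ)}(U)`, `R` the staple sum. -/
def cmLatCool (e : Fin N ≃ Fin 2 ⊕ m) (x : Site d L) (μ : Fin d)
    (U : GaugeConfig d L (Matrix.specialUnitaryGroup (Fin N) ℂ)) : GaugeConfig d L (Matrix.specialUnitaryGroup (Fin N) ℂ) :=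
  Pi.mulSingle (x, μ) (blockEmbSU e (cmUnit e (Scoring.stapleSum (suRep N) U x μ) (U (x, μ)))⁻¹) * U

/-- The hit link is the one-link cooling hit with the lattice staple sum. -/
theorem cmLatCool_apply_self (e : Fin N ≃ Fin 2 ⊕ m) (x : Site d L) (μ : Fin d)
    (U : GaugeConfig d L (Matrix.specialUnitaryGroup (Fin N) ℂ)) :
    cmLatCool e x μ U (x, μ) = cmCool e (Scoring.stapleSum (suRep N) U x μ) (U (x, μ)) := by
  rw [cmLatCool, Pi.mul_apply, Pi.mulSingle_eq_same, cmCool]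

/-- Off the link nothing moves. -/
theorem cmLatCool_apply_of_ne (e : Fin N ≃ Fin 2 ⊕ m) (x : Site d L) (μ : Fin d)
    (U : GaugeConfig d L (Matrix.specialUnitaryGroup (Fin N) ℂ)) {e' : Edge d L} (he : e' ≠ (x, μ)) :
    cmLatCool e x μ U e' = U e' := by
  rw [cmLatCool, Pi.mul_apply, Pi.mulSingle_eq_of_ne he, one_mul]

/-- **The hit beats every point of its coset**: `S_W(cmLatCool U) ≤ S_W(φ(A) ·_{(x,μ)} U)` for all `A ∈ SU(2)`
(`L ≥ 2`, so the staple sum does not read the link it updates). -/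
theorem wilsonAction_cmLatCool_le_coset [NeZero L] (hL : 2 ≤ L) (e : Fin N ≃ Fin 2 ⊕ m) (x : Site d L) (μ : Fin d)
    (U : GaugeConfig d L (Matrix.specialUnitaryGroup (Fin N) ℂ)) (A : Matrix.specialUnitaryGroup (Fin 2) ℂ) :
    wilsonAction (suRep N) (cmLatCool e x μ U) ≤ wilsonAction (suRep N) (Pi.mulSingle (x, μ) (blockEmbSU e A) * U) := by
  set R := Scoring.stapleSum (suRep N) U x μ with hR
  have h1 := Scoring.wilsonAction_mulSingle_sub (suRep N) hL continuous_suRep U x μ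
    (blockEmbSU e (cmUnit e R (U (x, μ)))⁻¹)
  have h2 := Scoring.wilsonAction_mulSingle_sub (suRep N) hL continuous_suRep U x μ (blockEmbSU e A)
  have hle := re_trace_coset_le_cmCool e R A (U (x, μ))
  rw [cmCool] at hle
  rw [suRep_apply, suRep_apply] at h1 h2
  rw [cmLatCool, ← hR]
  linarith

/-- **The engine's cooling hit never increases the Wilson action**: `S_W(cmLatCool U) ≤ S_W(U)` (`L ≥ 2`). -/
theorem wilsonAction_cmLatCool_le [NeZero L] (hL : 2 ≤ L) (e : Fin N ≃ Fin 2 ⊕ m) (x : Site d L) (μ : Fin d)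
    (U : GaugeConfig d L (Matrix.specialUnitaryGroup (Fin N) ℂ)) :
    wilsonAction (suRep N) (cmLatCool e x μ U) ≤ wilsonAction (suRep N) U := by
  have h := wilsonAction_cmLatCool_le_coset hL e x μ U 1
  rwa [map_one, Pi.mulSingle_one, one_mul] at h

/-- **A cooling schedule**: the hits of a list of (link, frame) pairs applied in order — the engine's `n_cool`
sweeps × (every link, serially) × (every pair `i < j`) is one such list. -/
def cmCoolSchedule : List (Edge d L × (Fin N ≃ Fin 2 ⊕ m)) →
    GaugeConfig d L (Matrix.specialUnitaryGroup (Fin N) ℂ) → GaugeConfig d L (Matrix.specialUnitaryGroup (Fin N) ℂ)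
  | [] => id
  | (h :: t) => fun U => cmCoolSchedule t (cmLatCool h.2 h.1.1 h.1.2 U)

/-- The empty schedule does nothing. -/
@[simp] theorem cmCoolSchedule_nil (U : GaugeConfig d L (Matrix.specialUnitaryGroup (Fin N) ℂ)) :
    cmCoolSchedule ([] : List (Edge d L × (Fin N ≃ Fin 2 ⊕ m))) U = U := rfl

/-- One hit, then the rest. -/
@[simp] theorem cmCoolSchedule_cons (h : Edge d L × (Fin N ≃ Fin 2 ⊕ m)) (t : List (Edge d L × (Fin N ≃ Fin 2 ⊕ m)))
    (U : GaugeConfig d L (Matrix.specialUnitaryGroup (Fin N) ℂ)) :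
    cmCoolSchedule (h :: t) U = cmCoolSchedule t (cmLatCool h.2 h.1.1 h.1.2 U) := rfl

/-- Concatenated schedules compose. -/
theorem cmCoolSchedule_append (l₁ l₂ : List (Edge d L × (Fin N ≃ Fin 2 ⊕ m)))
    (U : GaugeConfig d L (Matrix.specialUnitaryGroup (Fin N) ℂ)) :
    cmCoolSchedule (l₁ ++ l₂) U = cmCoolSchedule l₂ (cmCoolSchedule l₁ U) := by
  induction l₁ generalizing U with
  | nil => rfl
  | cons h t ih => exact ih _

/-- **COOLING NEVER INCREASES THE WILSON ACTION, FOR EVERY SCHEDULE** (`L ≥ 2`): whatever the visiting order,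
the number of sweeps and the subgroup order, `S_W(cmCoolSchedule l U) ≤ S_W(U)`. -/
theorem wilsonAction_cmCoolSchedule_le [NeZero L] (hL : 2 ≤ L) (l : List (Edge d L × (Fin N ≃ Fin 2 ⊕ m)))
    (U : GaugeConfig d L (Matrix.specialUnitaryGroup (Fin N) ℂ)) :
    wilsonAction (suRep N) (cmCoolSchedule l U) ≤ wilsonAction (suRep N) U := by
  induction l generalizing U with
  | nil => exact le_rfl
  | cons h t ih => exact (ih _).trans (wilsonAction_cmLatCool_le hL h.2 h.1.1 h.1.2 U)

/-- **More cooling never increases the action either**: continuing a schedule `l₁` by `l₂`. -/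
theorem wilsonAction_cmCoolSchedule_append_le [NeZero L] (hL : 2 ≤ L) (l₁ l₂ : List (Edge d L × (Fin N ≃ Fin 2 ⊕ m)))
    (U : GaugeConfig d L (Matrix.specialUnitaryGroup (Fin N) ℂ)) :
    wilsonAction (suRep N) (cmCoolSchedule (l₁ ++ l₂) U) ≤ wilsonAction (suRep N) (cmCoolSchedule l₁ U) := by
  rw [cmCoolSchedule_append]
  exact wilsonAction_cmCoolSchedule_le hL l₂ _

/-- The cooled action stays non-negative (so the non-increasing sequence of actions along any schedule is
bounded below). -/
theorem wilsonAction_cmCoolSchedule_nonneg [NeZero L] (l : List (Edge d L × (Fin N ≃ Fin 2 ⊕ m)))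
    (U : GaugeConfig d L (Matrix.specialUnitaryGroup (Fin N) ℂ)) :
    0 ≤ wilsonAction (suRep N) (cmCoolSchedule l U) :=
  Scoring.wilsonAction_nonneg_of_continuous (suRep N) continuous_suRep _

end Lattice

end Summit.Ventures.LatticeQCDFlow.Exactness
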